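/-
Copyright (c) 2026. All rights reserved.
Released under Apache 2.0 license as described in the file LICENSE.
-/
import Literature.Probability.FitznerVanDerHofstad2017.NobleBoundsNDispatchReg
import Literature.Probability.FitznerVanDerHofstad2017.NobleBoundsNLowStarStar
import Literature.Probability.FitznerVanDerHofstad2017.NobleBoundsNCoverPrime
import Literature.Probability.FitznerVanDerHofstad2017.NobleBoundsNEndC1
import Literature.Probability.FitznerVanDerHofstad2017.NobleBoundsNAssemblyStar
import HarnessLib

/-!
# Fitzner–van der Hofstad (2017), general `N`: the class estimate `h2` from per-pair junction packages

[FvdH17] R. Fitzner, R. van der Hofstad, *Mean-field behavior for nearest-neighbor percolation in `d > 10`*,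
Electron. J. Probab. **22** (2017) no. 43, arXiv:1506.07977v2: §6.1 (6.4) and "Case b = 0 / 1 / ≥ 2"
(pp. 58–59), §5.1 (5.4) and "Elements of the bounds" (pp. 48–49), §6.2.1 (6.48)–(6.51) (pp. 65–67),
App. B (pp. 74–78).

The consumer `NobleBoundsNGrouped.prod_bondJ_mul_piPerc_jwCover_le_chain_of_packages` turns junction packages
(`pkg`), a per-junction target bound (`hT`) and a last-junction bound (`hTL`) into the class estimate `h2` of
`NobleBoundsNAssemblyStar.tsum_nobleXiT_le_secStar_of_cover`.  This file fixes the GLOBAL TARGET FAMILY and proves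
`hT`, `hTL` and the bookkeeping half of `pkg` once and for all, so that `h2` over the pointwise extended family
`secStarBpt (blockBFullpt' (Letters.perc d p) X) 2 0` follows from PER-PAIR junction packages alone:

* §A (namespace `…NobleBlocks`): `tgtJ L κ α β` — by the class pair `(α, β) ∈ (Fin 3 ⊕ ★)²` of the junction, the
  landed families `tgtReg` (p200477's target), `tgtStarU` (`NobleBoundsNDispatchStarU`), `tgtStarL`, `tgtStarLU`
  (`NobleBoundsNDispatchStarL`); its column bound `sum_filter_tgtJ_le : Σ_{v ∈ P} tgtJ L κ α β … v ≤
  secStarBpt (blockBFullpt' L X) 2 0 κ α β …` for every four-line family `X` and every sub-family `P` of variants.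
* §B: the per-junction family `tgtAll` (first-junction prefix `starS (blockPS (Letters.perc d p)) (a_0) (u_0, w_0)`), the last
  target `tgtLast` (= the target of `NobleBoundsNEndC1.nonempty_jPkg_end_starA`), and `hT` / `hTL` in the
  consumer's literal form (`sum_filter_tgtAll_le`).
* §C: `nonempty_jPkg_all` — `pkg` for `jTarget M (tgtAll …) (tgtLast …) τ` at EVERY junction of an admissible
  variant, GIVEN packages for the three kinds of middle/first pairs that carry open cell slots: first regular
  pair (`hFR`), middle regular pair (`hMR`), middle lower-`★` pair (`hML`); the pairs `(regular, ★)` are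
  discharged by the landed `nonempty_jPkg_first_starU` / `nonempty_jPkg_mid_starU`, a `★★` pair by
  `NobleBoundsNLowStarStar.nonempty_jPkg_mid_starStar` on its two sections and is empty off them
  (`nonempty_jPkg_starStar_of_ne`), a closed first level is empty (`nonempty_jPkg_of_closed_zero`), and the last
  junction is `nonempty_jPkg_end_starA`.
* §D: `prod_bondJ_mul_piPerc_jwCover_le_secStar_of_pairPackages` — the class estimate `h2` over
  `secStarBpt (blockBFullpt' (Letters.perc d p) X) 2 0`, `starA (blockAbar' (Letters.perc d p)) (secEA (blockAbar' (Letters.perc d p)) 2)`, `starS (blockPE (Letters.perc d p))` from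
  the three per-pair package families (for all direction vectors and admissible variants).

The per-pair packages themselves are the DISPATCHERS `nonempty_jPkg_first_reg` / `nonempty_jPkg_mid_reg`
(`NobleBoundsNDispatchReg`) and `nonempty_jPkg_mid_starL` (`NobleBoundsNDispatchStarL`) applied to the class cells —
with their named hypothesis slots for the cells not yet in the tree — and the future `★★` cells; nothing about them
is asserted here.

Conventions: `d`-generic; nothing is cited as a fact; additive (no existing declaration is changed).
-/

noncomputable section

open scoped ENNReal

/-! ### A. The global target family by class pair and its column bound -/

namespace Literature.Probability.FitznerVanDerHofstad2017.NobleBlocks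

open Literature.Probability.LatticeModels
open Literature.Probability.FitznerVanDerHofstad2017.BlockSummation

variable {d : ℕ}

section TargetsJ

variable (L : Letters d) (κ : Fin d × Bool)

/-- **The global target family** of a first/middle junction by the CLASS PAIR `(α, β)` of its two levels
(`★ = Sum.inr`): regular/regular `tgtReg`, regular/`★` `tgtStarU`, `★`/regular `tgtStarL`, `★`/`★` `tgtStarLU`.
[cite: FitznerVanDerHofstad2017, §5.1 (5.4) (arXiv:1506.07977v2 p. 48) and "Elements of the bounds" (p. 49); §6.1 (6.4) (p. 58)] -/
def tgtJ : Fin 3 ⊕ Unit → Fin 3 ⊕ Unit → Site d → Site d → Site d → Site d → Site d → Site d → Bool × Fin 3 → ℝ≥0∞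
  | Sum.inl a₀, Sum.inl a' => tgtReg L κ a₀ a'
  | Sum.inl a₀, Sum.inr _ => tgtStarU L κ a₀
  | Sum.inr _, Sum.inl a' => tgtStarL L κ a'
  | Sum.inr _, Sum.inr _ => tgtStarLU L κ

/-- [cite: FitznerVanDerHofstad2017, §5.1 (5.4) (arXiv:1506.07977v2 p. 48)] -/
@[simp] theorem tgtJ_inl_inl (a₀ a' : Fin 3) : tgtJ L κ (Sum.inl a₀) (Sum.inl a') = tgtReg L κ a₀ a' := rfl

/-- [cite: FitznerVanDerHofstad2017, §5.1 (5.4) (arXiv:1506.07977v2 p. 48)] -/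
@[simp] theorem tgtJ_inl_inr (a₀ : Fin 3) (s : Unit) : tgtJ L κ (Sum.inl a₀) (Sum.inr s) = tgtStarU L κ a₀ := rfl

/-- [cite: FitznerVanDerHofstad2017, §5.1 (5.4) (arXiv:1506.07977v2 p. 48)] -/
@[simp] theorem tgtJ_inr_inl (s : Unit) (a' : Fin 3) : tgtJ L κ (Sum.inr s) (Sum.inl a') = tgtStarL L κ a' := rfl

/-- [cite: FitznerVanDerHofstad2017, §5.1 (5.4) (arXiv:1506.07977v2 p. 48)] -/
@[simp] theorem tgtJ_inr_inr (s s' : Unit) : tgtJ L κ (Sum.inr s) (Sum.inr s') = tgtStarLU L κ := rfl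

/-- **The column bound of the global target family**: over any sub-family `P` of variants,
`Σ_{v ∈ P} tgtJ L κ α β (u,w,t,z,w′,u′) v ≤ secStarBpt (blockBFullpt' L X) 2 0 κ α β (u,w,t,z,w′,u′)` — the
pointwise extended middle family of `NobleBoundsNAssemblyStar` over the primed pointwise block with four-line
family `X` (entries `B'_pt`, `𝟙{w′=u} B'_pt(…,u′,u′)`, `𝟙{z=w} B'_pt^{κ,2,a′}`, `𝟙{w′=u}𝟙{z=w} B'_pt^{κ,2,0}(…,u′,u′)`).
[cite: FitznerVanDerHofstad2017, §5.1 (5.4) (arXiv:1506.07977v2 p. 48) and "Elements of the bounds" (p. 49); §6.2.1 (6.49) (p. 65)] -/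
theorem sum_filter_tgtJ_le (X : DirBlockFamilyPt d) (P : Bool × Fin 3 → Prop) [DecidablePred P] :
    ∀ (α β : Fin 3 ⊕ Unit) (u w t z w' u' : Site d),
      ∑ v ∈ Finset.univ.filter P, tgtJ L κ α β u w t z w' u' v ≤
        secStarBpt (blockBFullpt' L X) 2 0 κ α β u w t z w' u'
  | Sum.inl a₀, Sum.inl a', u, w, t, z, w', u' => by
      rw [tgtJ_inl_inl, secStarBpt, starBpt_inl_inl]
      exact sum_filter_tgtReg_le_blockBFullpt' L κ a₀ a' u w t z w' u' X P
  | Sum.inl a₀, Sum.inr s, u, w, t, z, w', u' => by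
      rw [tgtJ_inl_inr, secStarBpt, starBpt_inl_inr]
      exact sum_filter_tgtStarU_le L κ a₀ u w t z w' u' X P
  | Sum.inr s, Sum.inl a', u, w, t, z, w', u' => by
      rw [tgtJ_inr_inl, secStarBpt, starBpt_inr_inl]
      exact sum_filter_tgtStarL_le L κ a' u w t z w' u' X P
  | Sum.inr s, Sum.inr s', u, w, t, z, w', u' => by
      rw [tgtJ_inr_inr, secStarBpt, starBpt_inr_inr]
      exact sum_filter_tgtStarLU_le L κ u w t z w' u' X P

end TargetsJ

end Literature.Probability.FitznerVanDerHofstad2017.NobleBlocks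

namespace Literature.Probability.FitznerVanDerHofstad2017

open Literature.Barriers.CriticalPhenomena Literature.Probability.Percolation
open Literature.Probability.LatticeModels Literature.Combinatorics.SimpleGraph _root_.SimpleGraph
open _root_.MeasureTheory
open Literature.Probability.FitznerVanDerHofstad2017.NobleBlocks
open Literature.Probability.FitznerVanDerHofstad2017.NobleBlocks.LenIdx
open Literature.Probability.FitznerVanDerHofstad2017.BlockSummation

variable {d : ℕ}

/-! ### B. The per-junction targets and the consumer's `hT` / `hTL` -/

section Targets

variable (L : Letters d) (M : ℕ) (x : Site d) (a : Fin (M + 2) → Fin 3 ⊕ Unit) (c : Fin 3 ⊕ Unit)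
  (b : Fin (M + 2) → Site d × Site d) (w t z : Fin (M + 2) → Site d) (κ : Fin (M + 2) → Fin d × Bool)

/-- **The target family of the first/middle junction `i`** under direction vector `κ`: the global family at the
class pair `(a_i, a_{i+1})` and the parameters `(u_i, w_i, t_i, z_i, w_{i+1}, u_{i+1})`, with the start factor
`starS (P^{S}) (a_0) (u_0, w_0)` at the first junction.
[cite: FitznerVanDerHofstad2017, §6.1 (6.4) (arXiv:1506.07977v2 p. 58); §5.1 (5.4) (p. 48)] -/
def tgtAll (i : Fin (M + 1)) (v : Bool × Fin 3) : ℝ≥0∞ :=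
  (if i = 0 then starS (blockPS L) (a (0 : Fin (M + 1)).castSucc) (b (0 : Fin (M + 1)).castSucc).1
      (w (0 : Fin (M + 1)).castSucc) else 1) *
    tgtJ L (κ i.castSucc) (a i.castSucc) (a i.succ) (b i.castSucc).1 (w i.castSucc) (t i.castSucc) (z i.castSucc)
      (w i.succ) (b i.succ).1 v

/-- **The target of the last junction**: `starA (Ā') (secEA Ā' 2)^{κ,a,c}(u,w,t,z) · starS (P^{E}) (c) (t − x, z − x)`
(the target of `NobleBoundsNEndC1.nonempty_jPkg_end_starA`).
[cite: FitznerVanDerHofstad2017, §6.1 (6.4) last factor (arXiv:1506.07977v2 p. 58); §5.1 (5.4) (p. 48)] -/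
def tgtLast : ℝ≥0∞ :=
  starA (blockAbar' L) (secEA (blockAbar' L) 2) (κ (Fin.last (M + 1))) (a (Fin.last (M + 1))) c
      (b (Fin.last (M + 1))).1 (w (Fin.last (M + 1))) (t (Fin.last (M + 1))) (z (Fin.last (M + 1))) *
    starS (blockPE L) c (t (Fin.last (M + 1)) - x) (z (Fin.last (M + 1)) - x)

/-- **`hT`** in the form consumed by `prod_bondJ_mul_piPerc_jwCover_le_chain_of_packages`, for
`S := starS (blockPS L)` and `Bpt := secStarBpt (blockBFullpt' L X) 2 0`.
[cite: FitznerVanDerHofstad2017, §5.1 (5.4) (arXiv:1506.07977v2 p. 48) and "Elements of the bounds" (p. 49); §6.1 (6.4) (p. 58)] -/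
theorem sum_filter_tgtAll_le (X : DirBlockFamilyPt d) (i : Fin (M + 1)) :
    ∑ v ∈ Finset.univ.filter (AdmV M a i), tgtAll L M a b w t z κ i v ≤
      (if i = 0 then starS (blockPS L) (a 0) (b 0).1 (w 0) else 1) *
        secStarBpt (blockBFullpt' L X) 2 0 (κ i.castSucc) (a i.castSucc) (a i.succ) (b i.castSucc).1 (w i.castSucc)
          (t i.castSucc) (z i.castSucc) (w i.succ) (b i.succ).1 := by
  unfold tgtAll
  rw [← Finset.mul_sum]
  exact mul_le_mul' le_rfl (sum_filter_tgtJ_le L (κ i.castSucc) X (AdmV M a i) _ _ _ _ _ _ _ _)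

end Targets

/-! ### C. `pkg` at every junction from per-pair packages -/

section Packages

variable (p : unitInterval) (M : ℕ) (x : Site d) (b : Fin (M + 2) → Site d × Site d) (w t z : Fin (M + 2) → Site d)
  (a : Fin (M + 2) → Fin 3 ⊕ Unit) (c : Fin 3 ⊕ Unit) (τ : Fin (M + 1) → Bool × Fin 3)


/-- **`pkg` from per-pair packages.**  For a direction vector `κ` of the pivotal bonds and an admissible variant
`τ`, packages at EVERY junction for the targets `jTarget M (tgtAll (Letters.perc d p) …) (tgtLast (Letters.perc d p) …) τ`, given packages for:
the first junction with a regular pair (`hFR`, target with the start factor `P^{S,a_0}(u_0,w_0)`), a middle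
junction with a regular pair (`hMR`), and a middle junction over a closed level with a regular upper class
(`hML`); §E the size-model inequality (5.34) at `N = M + 2` from the same three families
(`tsum_nobleXiT_le_secStar'_of_pairPackages`, via `NobleBoundsNCoverPrime`).  Discharged here: regular/`★` pairs (`nonempty_jPkg_first_starU`, `nonempty_jPkg_mid_starU`; the kind bit
is `false` by admissibility), `★★` pairs (`nonempty_jPkg_mid_starStar` on the sections `z_k = w_k`,
`w_{k+1} = u_k`, empty off them: `nonempty_jPkg_starStar_of_ne`), a closed FIRST level (empty:
`nonempty_jPkg_of_closed_zero`), the last junction (`nonempty_jPkg_end_starA`).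
[cite: FitznerVanDerHofstad2017, §6.1 (6.4) and "Case b = 0 / 1 / ≥ 2" (arXiv:1506.07977v2 pp. 58–59); §5.1 (5.4) (p. 48); (4.57)–(4.64) (pp. 41–42)] -/
theorem nonempty_jPkg_all (κ : Fin (M + 2) → Fin d × Bool) (hκ : ∀ i, (b i).2 = (b i).1 + stepVec (κ i))
    (hτ : AdmT M a τ)
    (hFR : ∀ a₀ a' : Fin 3, a (0 : Fin (M + 1)).castSucc = Sum.inl a₀ → a (0 : Fin (M + 1)).succ = Sum.inl a' →
      Nonempty (JPkg p (jctx M x b w t z a τ (0 : Fin (M + 1)).castSucc) (JFacts M x b w t z a c τ)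
        (blockPS (Letters.perc d p) a₀ (b (0 : Fin (M + 1)).castSucc).1 (w (0 : Fin (M + 1)).castSucc) *
          tgtReg (Letters.perc d p) (κ (0 : Fin (M + 1)).castSucc) a₀ a' (b (0 : Fin (M + 1)).castSucc).1
            (w (0 : Fin (M + 1)).castSucc) (t (0 : Fin (M + 1)).castSucc) (z (0 : Fin (M + 1)).castSucc)
            (w (0 : Fin (M + 1)).succ) (b (0 : Fin (M + 1)).succ).1 (τ 0))))
    (hMR : ∀ i i₀ : Fin (M + 1), i₀.succ = i.castSucc → ∀ a₀ a' : Fin 3, a i.castSucc = Sum.inl a₀ →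
      a i.succ = Sum.inl a' →
      Nonempty (JPkg p (jctx M x b w t z a τ i.castSucc) (JFacts M x b w t z a c τ)
        (tgtReg (Letters.perc d p) (κ i.castSucc) a₀ a' (b i.castSucc).1 (w i.castSucc) (t i.castSucc) (z i.castSucc) (w i.succ)
          (b i.succ).1 (τ i))))
    (hML : ∀ i i₀ : Fin (M + 1), i₀.succ = i.castSucc → ∀ (u₀ : Unit) (a' : Fin 3), a i.castSucc = Sum.inr u₀ →
      a i.succ = Sum.inl a' →
      Nonempty (JPkg p (jctx M x b w t z a τ i.castSucc) (JFacts M x b w t z a c τ)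
        (tgtStarL (Letters.perc d p) (κ i.castSucc) a' (b i.castSucc).1 (w i.castSucc) (t i.castSucc) (z i.castSucc) (w i.succ)
          (b i.succ).1 (τ i)))) :
    ∀ k, Nonempty (JPkg p (jctx M x b w t z a τ k) (JFacts M x b w t z a c τ)
      (jTarget M (tgtAll (Letters.perc d p) M a b w t z κ) (tgtLast (Letters.perc d p) M x a c b w t z κ) τ k)) := by
  intro k
  induction k using Fin.lastCases with
  | last =>
      simp only [jTarget, Fin.lastCases_last]
      exact nonempty_jPkg_end_starA p M x b w t z a c τ (κ _) (hκ _)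
  | cast i =>
      simp only [jTarget, Fin.lastCases_castSucc]
      -- the kind bit of a level below a closed one is `false` (admissibility)
      have hσ : ∀ u₁ : Unit, a i.succ = Sum.inr u₁ → (τ i).1 = false := fun u₁ h => hτ i (by rw [h]; rfl)
      rcases Fin.eq_zero_or_eq_succ i with rfl | ⟨j, rfl⟩
      · -- the FIRST junction
        rw [tgtAll, if_pos rfl]
        rcases ha : a (0 : Fin (M + 1)).castSucc with a₀ | u₀
        · rcases ha' : a (0 : Fin (M + 1)).succ with a' | u₁
          · rw [starS_inl, tgtJ_inl_inl]
            exact hFR a₀ a' ha ha'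
          · rw [starS_inl, tgtJ_inl_inr]
            exact nonempty_jPkg_first_starU p M x b w t z a c τ (κ _) (hκ _) a₀ ha ha' (hσ u₁ ha')
        · exact nonempty_jPkg_of_closed_zero p M x b w t z a c τ ha _ _
      · -- a MIDDLE junction `k = j + 1`
        rw [tgtAll, if_neg (Fin.succ_ne_zero j), one_mul]
        have hk : (j.castSucc).succ = (j.succ).castSucc := Fin.succ_castSucc j
        rcases ha : a j.succ.castSucc with a₀ | u₀
        · rcases ha' : a j.succ.succ with a' | u₁
          · rw [tgtJ_inl_inl]
            exact hMR _ _ hk a₀ a' ha ha'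
          · rw [tgtJ_inl_inr]
            exact nonempty_jPkg_mid_starU p M x b w t z a c τ _ _ hk (κ _) (hκ _) a₀ ha ha' (hσ u₁ ha')
        · rcases ha' : a j.succ.succ with a' | u₁
          · rw [tgtJ_inr_inl]
            exact hML _ _ hk u₀ a' ha ha'
          · rw [tgtJ_inr_inr]
            by_cases hs : z j.succ.castSucc = w j.succ.castSucc ∧ w j.succ.succ = (b j.succ.castSucc).1
            · exact nonempty_jPkg_mid_starStar p M x b w t z a c τ _ _ hk (κ _) (hκ _) ha ha' hs.1 hs.2
            · exact nonempty_jPkg_starStar_of_ne p M x b w t z a c τ _ _ hk ha ha' (not_and_or.mp hs) _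

end Packages

/-! ### D. The class estimate `h2` over `secStarBpt (blockBFullpt' (Letters.perc d p) X) 2 0` from per-pair packages -/

section ClassEstimate

variable (p : unitInterval) (M : ℕ) (x : Site d)


/-- **THE CLASS ESTIMATE `h2` FROM PER-PAIR JUNCTION PACKAGES** (the `h2` hypothesis of
`NobleBoundsNAssemblyStar.tsum_nobleXiT_le_secStar_of_cover`, over the PRIMED pointwise middle block with four-line
family `X`): at `(a, c, b⃗, w⃗, t⃗, z⃗)`, packages for the first regular pair, the middle regular pairs, the middle
lower-`★` pairs and the `★★` pairs on their sections — for every direction vector and admissible variant — give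
`(∏_i J(b_i)) · ℙ^{⊗(M+3)}(E ∩ C(a,c)) ≤ Σ_κ 𝟙{b = (u, u + e_κ)} · starS(P^S)^{a_0}(u_0,w_0) ·
chainTail (secStarBpt (B'_pt) 2 0) (starA Ā' (secEA Ā' 2)) (starS P^E)`.
[cite: FitznerVanDerHofstad2017, §6.1 (6.4) pp. 58–59, §6.2.1 (6.48)–(6.51) pp. 65–67, §5.1 (5.4) p. 48, App. B pp. 74–78 (arXiv:1506.07977v2)] -/
theorem prod_bondJ_mul_piPerc_jwCover_le_secStar_of_pairPackages (X : DirBlockFamilyPt d)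
    (a : Fin (M + 2) → Fin 3 ⊕ Unit) (c : Fin 3 ⊕ Unit) (b : Fin (M + 2) → Site d × Site d)
    (w t z : Fin (M + 2) → Site d)
    (hFR : ∀ κ : Fin (M + 2) → Fin d × Bool, (∀ i, (b i).2 = (b i).1 + stepVec (κ i)) →
      ∀ τ : Fin (M + 1) → Bool × Fin 3, AdmT M a τ →
      ∀ a₀ a' : Fin 3, a (0 : Fin (M + 1)).castSucc = Sum.inl a₀ → a (0 : Fin (M + 1)).succ = Sum.inl a' →
      Nonempty (JPkg p (jctx M x b w t z a τ (0 : Fin (M + 1)).castSucc) (JFacts M x b w t z a c τ)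
        (blockPS (Letters.perc d p) a₀ (b (0 : Fin (M + 1)).castSucc).1 (w (0 : Fin (M + 1)).castSucc) *
          tgtReg (Letters.perc d p) (κ (0 : Fin (M + 1)).castSucc) a₀ a' (b (0 : Fin (M + 1)).castSucc).1
            (w (0 : Fin (M + 1)).castSucc) (t (0 : Fin (M + 1)).castSucc) (z (0 : Fin (M + 1)).castSucc)
            (w (0 : Fin (M + 1)).succ) (b (0 : Fin (M + 1)).succ).1 (τ 0))))
    (hMR : ∀ κ : Fin (M + 2) → Fin d × Bool, (∀ i, (b i).2 = (b i).1 + stepVec (κ i)) →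
      ∀ τ : Fin (M + 1) → Bool × Fin 3, AdmT M a τ →
      ∀ i i₀ : Fin (M + 1), i₀.succ = i.castSucc → ∀ a₀ a' : Fin 3, a i.castSucc = Sum.inl a₀ →
      a i.succ = Sum.inl a' →
      Nonempty (JPkg p (jctx M x b w t z a τ i.castSucc) (JFacts M x b w t z a c τ)
        (tgtReg (Letters.perc d p) (κ i.castSucc) a₀ a' (b i.castSucc).1 (w i.castSucc) (t i.castSucc) (z i.castSucc) (w i.succ)
          (b i.succ).1 (τ i))))
    (hML : ∀ κ : Fin (M + 2) → Fin d × Bool, (∀ i, (b i).2 = (b i).1 + stepVec (κ i)) →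
      ∀ τ : Fin (M + 1) → Bool × Fin 3, AdmT M a τ →
      ∀ i i₀ : Fin (M + 1), i₀.succ = i.castSucc → ∀ (u₀ : Unit) (a' : Fin 3), a i.castSucc = Sum.inr u₀ →
      a i.succ = Sum.inl a' →
      Nonempty (JPkg p (jctx M x b w t z a τ i.castSucc) (JFacts M x b w t z a c τ)
        (tgtStarL (Letters.perc d p) (κ i.castSucc) a' (b i.castSucc).1 (w i.castSucc) (t i.castSucc) (z i.castSucc) (w i.succ)
          (b i.succ).1 (τ i)))) :
    (∏ i, ENNReal.ofReal (bondJ d p ((b i).2 - (b i).1))) *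
        piPerc d p (M + 3) (jwCoverE M x b w t z ∩ jwCoverC M x b w t z a c) ≤
      ∑ κ : Fin (M + 2) → Fin d × Bool, dirInd stepVec κ b *
        (starS (blockPS (Letters.perc d p)) (a 0) (b 0).1 (w 0) *
          chainTail (secStarBpt (blockBFullpt' (Letters.perc d p) X) 2 0) (starA (blockAbar' (Letters.perc d p)) (secEA (blockAbar' (Letters.perc d p)) 2))
            (starS (blockPE (Letters.perc d p))) x (M + 1) κ a c b w t z) :=
  prod_bondJ_mul_piPerc_jwCover_le_chain_of_packages p M x (starS (blockPS (Letters.perc d p))) (secStarBpt (blockBFullpt' (Letters.perc d p) X) 2 0)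
    (starA (blockAbar' (Letters.perc d p)) (secEA (blockAbar' (Letters.perc d p)) 2)) (starS (blockPE (Letters.perc d p))) a c b w t z (tgtAll (Letters.perc d p) M a b w t z)
    (tgtLast (Letters.perc d p) M x a c b w t z)
    (fun κ hκ τ hτ => nonempty_jPkg_all p M x b w t z a c τ κ hκ hτ (hFR κ hκ τ hτ) (hMR κ hκ τ hτ) (hML κ hκ τ hτ))
    (fun κ _ i => sum_filter_tgtAll_le (Letters.perc d p) M a b w t z κ X i) fun _ _ => le_rfl

end ClassEstimate

/-! ### E. (5.34) at `N = M + 2` from per-pair packages -/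

section SizeModel

open scoped Matrix
open Literature.Probability.FitznerVanDerHofstad2017.BlockSummation

variable (p : unitInterval) (M : ℕ)

/-- **(5.34) AT `N = M + 2` FROM PER-PAIR JUNCTION PACKAGES** (section choice of `NobleBoundsNCoverPrime`): if at
every `(x, a, c, b⃗, w⃗, t⃗, z⃗)` the three per-pair package families of
`prod_bondJ_mul_piPerc_jwCover_le_secStar_of_pairPackages` are available (first regular pair, middle regular pairs,
middle lower-`★` pairs; the `★`-upper and `★★` pairs are discharged in this file), then for every four-line remainder
family `X` summing to a translation-invariant `X₂`,
`Σ_x Ξ̂^{(M+2)}(x) ≤ (P^S)ᵗ · B_sec^{M+1} · Ā_sec · P^E` over `Fin 3 ⊕ Unit` — `NobleBoundsNCoverPrime.tsum_nobleXiT_le_secStar'_of_cover`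
with `hC`, `h1` the cover of `NobleJointNLevel` (`jwCoverE_subset_iUnion_jwCoverC`, `nobleXiT_succ_succ_le_jwCoverE`)
and `h2` the class estimate of §D.
[cite: FitznerVanDerHofstad2017, Prop. 5.5 (5.34) (arXiv:1506.07977v2 p. 53); §5.1 (5.4) (p. 48) and "Elements of the bounds" (p. 49); §6.1 (6.4) (pp. 58–59); Lemma 6.1, §6.2.1 (6.48)–(6.51) (pp. 65–67)] -/
theorem tsum_nobleXiT_le_secStar'_of_pairPackages (X : DirBlockFamilyPt d) (X₂ : DirBlockFamily d)
    (hXsum : ∀ κ a a' u w w' u', ∑' t, ∑' z, X κ a a' u w t z w' u' = X₂ κ a a' u w w' u')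
    (hX₂ti : ∀ ι a b, IsTransInv (X₂ ι a b)) (hXti : ∀ κ a a', IsTransInv₆ (X κ a a'))
    (hFR : ∀ (x : Site d) (a : Fin (M + 2) → Fin 3 ⊕ Unit) (c : Fin 3 ⊕ Unit) (b : Fin (M + 2) → Site d × Site d)
      (w t z : Fin (M + 2) → Site d),
      ∀ κ : Fin (M + 2) → Fin d × Bool, (∀ i, (b i).2 = (b i).1 + stepVec (κ i)) →
      ∀ τ : Fin (M + 1) → Bool × Fin 3, AdmT M a τ →
      ∀ a₀ a' : Fin 3, a (0 : Fin (M + 1)).castSucc = Sum.inl a₀ → a (0 : Fin (M + 1)).succ = Sum.inl a' →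
      Nonempty (JPkg p (jctx M x b w t z a τ (0 : Fin (M + 1)).castSucc) (JFacts M x b w t z a c τ)
        (blockPS (Letters.perc d p) a₀ (b (0 : Fin (M + 1)).castSucc).1 (w (0 : Fin (M + 1)).castSucc) *
          tgtReg (Letters.perc d p) (κ (0 : Fin (M + 1)).castSucc) a₀ a' (b (0 : Fin (M + 1)).castSucc).1
            (w (0 : Fin (M + 1)).castSucc) (t (0 : Fin (M + 1)).castSucc) (z (0 : Fin (M + 1)).castSucc)
            (w (0 : Fin (M + 1)).succ) (b (0 : Fin (M + 1)).succ).1 (τ 0))))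
    (hMR : ∀ (x : Site d) (a : Fin (M + 2) → Fin 3 ⊕ Unit) (c : Fin 3 ⊕ Unit) (b : Fin (M + 2) → Site d × Site d)
      (w t z : Fin (M + 2) → Site d),
      ∀ κ : Fin (M + 2) → Fin d × Bool, (∀ i, (b i).2 = (b i).1 + stepVec (κ i)) →
      ∀ τ : Fin (M + 1) → Bool × Fin 3, AdmT M a τ →
      ∀ i i₀ : Fin (M + 1), i₀.succ = i.castSucc → ∀ a₀ a' : Fin 3, a i.castSucc = Sum.inl a₀ →
      a i.succ = Sum.inl a' →
      Nonempty (JPkg p (jctx M x b w t z a τ i.castSucc) (JFacts M x b w t z a c τ)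
        (tgtReg (Letters.perc d p) (κ i.castSucc) a₀ a' (b i.castSucc).1 (w i.castSucc) (t i.castSucc) (z i.castSucc) (w i.succ)
          (b i.succ).1 (τ i))))
    (hML : ∀ (x : Site d) (a : Fin (M + 2) → Fin 3 ⊕ Unit) (c : Fin 3 ⊕ Unit) (b : Fin (M + 2) → Site d × Site d)
      (w t z : Fin (M + 2) → Site d),
      ∀ κ : Fin (M + 2) → Fin d × Bool, (∀ i, (b i).2 = (b i).1 + stepVec (κ i)) →
      ∀ τ : Fin (M + 1) → Bool × Fin 3, AdmT M a τ →
      ∀ i i₀ : Fin (M + 1), i₀.succ = i.castSucc → ∀ (u₀ : Unit) (a' : Fin 3), a i.castSucc = Sum.inr u₀ →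
      a i.succ = Sum.inl a' →
      Nonempty (JPkg p (jctx M x b w t z a τ i.castSucc) (JFacts M x b w t z a c τ)
        (tgtStarL (Letters.perc d p) (κ i.castSucc) a' (b i.castSucc).1 (w i.castSucc) (t i.castSucc) (z i.castSucc) (w i.succ)
          (b i.succ).1 (τ i)))) :
    ∑' x, nobleXiT d p (M + 2) x ≤
      vecP (starS (blockPS (Letters.perc d p))) ᵥ*
        matB (starB (blockBFull' (Letters.perc d p) X₂) (secEc (blockBFullpt' (Letters.perc d p) X) 0)
          (secEo (blockBFullpt' (Letters.perc d p) X) 2) (secEoc (blockBFullpt' (Letters.perc d p) X) 2 0)) ^ (M + 1) ᵥ*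
          matAbar (starA (blockAbar' (Letters.perc d p)) (secEA (blockAbar' (Letters.perc d p)) 2)) ⬝ᵥ
        vecP (starS (blockPE (Letters.perc d p))) :=
  tsum_nobleXiT_le_secStar'_of_cover p (M + 1) X X₂ hXsum hX₂ti hXti (fun x b w t z => jwCoverE M x b w t z)
    (fun x b w t z a c => jwCoverC M x b w t z a c) (fun x => jwCoverE_subset_iUnion_jwCoverC M x)
    (fun x => nobleXiT_succ_succ_le_jwCoverE p M x)
    fun x a c b w t z => prod_bondJ_mul_piPerc_jwCover_le_secStar_of_pairPackages p M x X a c b w t z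
      (hFR x a c b w t z) (hMR x a c b w t z) (hML x a c b w t z)

end SizeModel

end Literature.Probability.FitznerVanDerHofstad2017

end
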